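import Summits.AtomisticToContinuum.Crystallization.Theorems.FrustratedLawDichotomyCellF1Labels
import Summits.AtomisticToContinuum.Crystallization.Theorems.FrustratedLawDichotomyCellHostMirror

/-!
# FrustratedLawDichotomy · crux `AperiodicFrustratedLawGap` (stmt-AtomisticToContinuum-27623) — class-A K-file skeleton, layer 2c:
WINDOW COMPLETENESS and the MIRROR HOST hypotheses of the F1 cell, list-free (decomp-a2c hand-2 g47, structural share; host column of record
for Bravais cells = hand-1 `…CellHostMirror`, crit r1805 (B5) / r1815 (B): «the ONE new Labels-file fact it needs: off-M parity labels have
q ≥ Z_c + 1, + R_w²·D² ≤ (1−3ε)(Z_c+1)»)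

F1 is Bravais (every site a centre of inversion), so its host column is the MIRROR column: near part ≡ 0, `nbh := mirrorNbh MF1 mirT`, and the
(251) side condition `hnbh` follows from WINDOW COMPLETENESS.  This file discharges, for the F1 label set `MF1` of layer 2, everything of that
column that does not depend on the per-label dial `Lh` or on readings:
* `offM_qk` — a parity label NOT in `MF1` has class key `≥ BL + 1` (membership by predicate, layer 2 `mem_M`);
* `RwF1 = 13271/1024 ≈ 12.96` — the completeness radius: `RwF1²·2²⁸ ≤ (1 − 3ε)(BL + 1)` (one `norm_num`), whence by hand-1's `hfar_of_intWindow` /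
  `hout_of_nearId`: ★ `hout_F1` — under every `F` of the strain cell, every parity label off `MF1` is placed at distance `≥ RwF1` from the root;
* `hadm_F1` (the mirror `mirT m m' = 2m − m'` of a label in an interior label is a parity label) and `hrev_F1` (bond reversal for the linear template);
* ★ `hnbh_F1` — the (251) `hnbh` hypothesis VERBATIM for `nbh := mirrorNbh MF1 mirT` over `MIF1`, from any dial `Lh` with `Lh m + ‖posL F (T·z m)‖ ≤ RwF1`.
-/

namespace Summit.AtomisticToContinuum.Crystallization.Theorems.FrustratedLawDichotomyCellF1Host

open scoped BigOperators
open Summit.AtomisticToContinuum.Crystallization.Theorems.FrustratedLawDichotomyCellMetric (posL)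
open Summit.AtomisticToContinuum.Crystallization.Theorems.FrustratedLawDichotomyCellTriples (zT sumT)
open Summit.AtomisticToContinuum.Crystallization.Theorems.FrustratedLawDichotomyCellHostMirror
  (mirrorNbh mirT even_sumT_mirT posL_linTemplate_mirT hout_of_nearId hfar_of_intWindow hnbh_of_window)
open Summit.AtomisticToContinuum.Crystallization.Theorems.FrustratedLawDichotomyCellF1Frame (T qk BL admL admL_iff sumSq_T)
open Summit.AtomisticToContinuum.Crystallization.Theorems.FrustratedLawDichotomyCellF1Labels (MF1 MIF1 mem_M MI_subset_M hpar)

/-- the window-completeness radius of the F1 cell: `13271/1024 ≈ 12.96` (the largest dyadic `R` with `R²·2²⁸ ≤ (1 − 3ε)(BL + 1)`; `Rc − τ = 12.999`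
is NOT available because the lower norm bound on the strain cell carries the factor `1 − 3ε`). -/
noncomputable def RwF1 : ℝ := 13271 / 1024

/-- a parity label off `MF1` has class key at least `BL + 1` (membership by predicate). -/
theorem offM_qk : ∀ x : ℤ × ℤ × ℤ, Even (sumT x) → x ∉ MF1 → BL + 1 ≤ qk x := by
  intro x hx hxM
  by_contra hlt
  exact hxM (mem_M.mpr ((admL_iff x).mpr ⟨hx, by omega⟩))

/-- the one rational check: `RwF1²·2²⁸ ≤ (1 − 3ε)(BL + 1)`. -/
theorem RwF1_check : RwF1 ^ 2 * (16384 : ℝ) ^ 2 ≤ (1 - 3 * (1 / 1024 : ℝ)) * ((BL : ℝ) + 1) := by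
  unfold RwF1 BL; norm_num

/-- the template form of completeness: off `MF1`, `RwF1² ≤ (1 − 3ε)·Σᵢ (T·z)ᵢ²`. -/
theorem hfar_F1 : ∀ x : ℤ × ℤ × ℤ, Even (sumT x) → x ∉ MF1 →
    RwF1 ^ 2 ≤ (1 - 3 * (1 / 1024 : ℝ)) * ∑ i, (T.mulVec (fun j => (zT x j : ℝ)) i) ^ 2 :=
  hfar_of_intWindow (M := MF1) (adm := fun x : ℤ × ℤ × ℤ => Even (sumT x)) (a := fun x => T.mulVec fun j => (zT x j : ℝ))
    (q := qk) (D := 16384) (by norm_num) sumSq_T (by norm_num) RwF1_check offM_qk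

/-- ★ WINDOW COMPLETENESS of the F1 cell: under every `F` of the strain cell, a parity label NOT in `MF1` is placed at distance `≥ RwF1` from the root. -/
theorem hout_F1 {F : Matrix (Fin 3) (Fin 3) ℝ} (hG : ∀ i j, |(F.transpose * F) i j - (if i = j then 1 else 0)| ≤ 1 / 1024) :
    ∀ x : ℤ × ℤ × ℤ, Even (sumT x) → x ∉ MF1 → RwF1 ≤ ‖posL F (T.mulVec fun j => (zT x j : ℝ))‖ :=
  hout_of_nearId hG hfar_F1

/-- the mirror image `2m − m'` of a label `m'` in an interior label `m` is a parity label. -/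
theorem hadm_F1 : ∀ m ∈ MIF1, ∀ m' ∈ MF1, Even (sumT (mirT m m')) :=
  fun m _ m' hm' => even_sumT_mirT m (hpar m' hm')

/-- bond reversal of the linear template under the label mirror. -/
theorem hrev_F1 (F : Matrix (Fin 3) (Fin 3) ℝ) : ∀ m ∈ MIF1, ∀ m' ∈ MF1,
    posL F (T.mulVec fun i => (zT m i : ℝ)) - posL F (T.mulVec fun i => (zT (mirT m m') i : ℝ))
      = -(posL F (T.mulVec fun i => (zT m i : ℝ)) - posL F (T.mulVec fun i => (zT m' i : ℝ))) :=
  fun m _ m' _ => posL_linTemplate_mirT F T m m'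

/-- ★ the (251) `hnbh` HYPOTHESIS for the F1 cell with `nbh := mirrorNbh MF1 mirT`, from any per-label dial `Lh` with `Lh m + ‖a_F m‖ ≤ RwF1`:
every label of `MF1` off the mirror core of an interior label `m` is at distance `≥ Lh m` from it. -/
theorem hnbh_F1 {F : Matrix (Fin 3) (Fin 3) ℝ} (hG : ∀ i j, |(F.transpose * F) i j - (if i = j then 1 else 0)| ≤ 1 / 1024)
    {Lh : ℤ × ℤ × ℤ → ℝ} (hLw : ∀ m ∈ MIF1, Lh m + ‖posL F (T.mulVec fun j => (zT m j : ℝ))‖ ≤ RwF1) :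
    ∀ m ∈ MIF1, ∀ m' ∈ MF1, m' ≠ m → m' ∉ mirrorNbh MF1 mirT m →
      Lh m ≤ dist (posL F (T.mulVec fun j => (zT m' j : ℝ))) (posL F (T.mulVec fun j => (zT m j : ℝ))) :=
  hnbh_of_window (MI := MIF1) (pos := fun x => posL F (T.mulVec fun j => (zT x j : ℝ))) (mir := mirT)
    (hout_F1 hG) hadm_F1 (hrev_F1 F) hLw

end Summit.AtomisticToContinuum.Crystallization.Theorems.FrustratedLawDichotomyCellF1Host
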